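import Summits.Schanuel.Schanuel.Theses.RigidCore
import Summits.Schanuel.Schanuel.Theorems.RigidCoreSparsityTwoTaylorLogCoeffsAlgebraic
import Summits.Schanuel.Schanuel.Theorems.RigidCoreSparsityTwoRothCuspFinite
import Summits.Schanuel.Schanuel.Theorems.RigidCoreSparsityTwoSplitLemmas

/-!
# The split of `RigidCore.SparsityTwo`, part 3: the LINEAR-JET case at a log-free cusp (W-free)

Line `cusp-germ-schneider-sparsity` of the crux `RigidCore.SparsityTwo` (item stmt-Schanuel-0971). This file
isolates the W-free heart of the split `★⁺ ⇐ atoms + pockets` (lead gens 1/c1, moved out of the Cruxes skeleton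
so that it is importable): on a normalised log-free cusp ray with algebraic uniformisation
`(N₀, T, ℓ₀, ℓ₁, Φ₁, r)`, NON-constant exponential coordinates and a LINEAR `t`-jet
`Φ₁ t / t^{N₀} = β t⁻ᵉ + G t` with `β ∈ ℚ̄`, the ray hits are finitely many GIVEN
* the deep pocket (`stub_deepCuspFinite`, landed p87226 — passed here as the hypothesis `hDeep` with its
  registered statement, because its module is not yet built on the hub; discharged by import downstream),
* the Roth pocket (`stub_rothCuspFinite`, landed p97601, imported),
* the arithmetic normal form (`stub_taylorLogCoeffsAlgebraic`, landed, imported), and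
* the two linear atoms A2 (`stub_inhomogeneousCuspAtom`) and A1 (`stub_linearCuspAtom`) SPECIALISED to the
  cusp at hand (hypotheses `hA2`, `hA1`: exactly the registered atom statements partially applied up to
  the linking identities, so that `RigidCoreSparsityTwoOfAtoms` feeds the verbatim atoms by application).
Steps: `A = β w^e + a₀` (`linearJet_normalForm` of `RigidCoreSparsityTwoSplitLemmas`: `A(σ⁻¹) - β σ⁻ᵉ` is a germ
continuous at `0`, hence a constant polynomial in `σ⁻¹`); `β` real (reality of the jet) and irrational (else the `q(N) + c` exclusion
fires); Taylor coefficients of `G` algebraic (`R₃(X, βX + Y)` fed to the ANF); the defect germ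
`Φ = β(ℓ₀ - ℓ₀ 0) - (ℓ₁ - ℓ₁ 0) + G`, the identity `2πi g σ = Φ(T σ) + (β ℓ₀ 0 - ℓ₁ 0 - 2πi a₀)`, hence the
hit identity `2πi L = 2πi β n + Φ(T σ_n) + (β ℓ₀ 0 - ℓ₁ 0)`; `Φ ≢ 0` (else `g` is constant, `= 0`:
transcendence of the tail with `P = X₁`); torsion-homogeneous cusps: order `k` of `Φ`, then deep pocket
(`k ≥ e(d-1)`), Roth pocket (`e < k`) or A1 (`k ≤ e`) after the transport `L' = q L + m₁`; otherwise A2.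
No unproved facts; axioms standard.
-/

set_option linter.dupNamespace false

namespace Summit.Schanuel.Schanuel.Cruxes.SparsityTwo.CuspGermSchneiderSparsity

open Filter Topology Complex Polynomial Literature.NumberTheory.Transcendental
open scoped Real

/-- **The linear-jet case of the split (W-free).** See the module docstring. The hypotheses are, in order:
the σ-side cusp data with three of its proved facts (transcendental tail `htr`, jet not `q(N) + c` `hrat`,
reality `hreal`; lacunarity is not needed in the linear case once the atoms are applied), the linking identities of the algebraic uniformisation, a `ℚ`-curve
`W'` through the `t`-branch and the six rational coordinate relations (only passed on to the atoms, except
`R₃`, the relation between the two additive coordinates, which feeds the ANF for `G`), the ANF outputs,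
the linear jet `(G, β)` with `β ∈ ℚ̄`, non-constancy of the exponential coordinates, the deep pocket
`hDeep` (registered statement of `stub_deepCuspFinite`), and the atoms A2/A1 at this cusp. -/
theorem rayHits_finite_linearJet :
    ∀ (e N₀ : ℕ) (A : Polynomial ℂ) (g ℓu ℓv T ℓ₀ ℓ₁ Φ₁ G : ℂ → ℂ) (ρ r : ℝ) (β : ℂ),
      let w : ℕ → ℂ := fun n => (((n : ℝ) ^ ((e : ℝ)⁻¹) : ℝ) : ℂ);
      let x : ℕ → Fin 2 → ℂ := fun n =>
        ![2 * ↑π * I * (n : ℂ) + ℓu (w n)⁻¹, 2 * ↑π * I * (A.eval (w n) + g (w n)⁻¹) + ℓv (w n)⁻¹];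
      0 < e → 0 < ρ → 0 < r → AnalyticAt ℂ g 0 → g 0 = 0 → AnalyticAt ℂ ℓu 0 → AnalyticAt ℂ ℓv 0 →
      AnalyticAt ℂ T 0 → T 0 = 0 → AnalyticAt ℂ ℓ₀ 0 → AnalyticAt ℂ ℓ₁ 0 → AnalyticAt ℂ Φ₁ 0 →
      (¬ ∃ P : MvPolynomial (Fin 2) ℂ, P ≠ 0 ∧
          ∀ᶠ z in 𝓝 (0 : ℂ), MvPolynomial.eval ![z, g z] P = 0) →
      (¬ ∃ (q : Polynomial ℚ) (c : ℂ), ∀ N : ℕ,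
          A.eval (w N) = (q.map (algebraMap ℚ ℂ)).eval (N : ℂ) + c) →
      ((∀ k : ℕ, (A.coeff k).im = 0) ∧ ∀ᶠ u : ℝ in 𝓝[>] 0, (g (u : ℂ)).im = 0) →
      (∀ σ : ℂ, 0 < ‖σ‖ → ‖σ‖ < ρ → 0 < ‖T σ‖ ∧ ‖T σ‖ < r ∧
        ((T σ) ^ e)⁻¹ = 2 * ↑π * I * σ⁻¹ ^ e + ℓu σ ∧
        Φ₁ (T σ) / (T σ) ^ N₀ = 2 * ↑π * I * (A.eval σ⁻¹ + g σ) + ℓv σ ∧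
        ℓ₀ (T σ) = ℓu σ ∧ ℓ₁ (T σ) = ℓv σ) →
      (∃ W' : Set (Fin 2 ⊕ Fin 2 → ℂ), IsDefinedOver (⊥ : Subfield ℂ) W' ∧ zariskiDim ℂ W' < 2 ∧
        ∀ t : ℂ, 0 < ‖t‖ → ‖t‖ < r →
          Sum.elim (![(t ^ e)⁻¹, Φ₁ t / t ^ N₀] : Fin 2 → ℂ)
            (![Complex.exp (ℓ₀ t), Complex.exp (ℓ₁ t)] : Fin 2 → ℂ) ∈ W') →
      (∃ R : MvPolynomial (Fin 2) ℚ, R ≠ 0 ∧ ∀ t : ℂ, 0 < ‖t‖ → ‖t‖ < r →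
        MvPolynomial.aeval ![(t ^ e)⁻¹, Complex.exp (ℓ₀ t)] R = 0) →
      (∃ R : MvPolynomial (Fin 2) ℚ, R ≠ 0 ∧ ∀ t : ℂ, 0 < ‖t‖ → ‖t‖ < r →
        MvPolynomial.aeval ![(t ^ e)⁻¹, Complex.exp (ℓ₁ t)] R = 0) →
      (∃ R : MvPolynomial (Fin 2) ℚ, R ≠ 0 ∧ ∀ t : ℂ, 0 < ‖t‖ → ‖t‖ < r →
        MvPolynomial.aeval ![(t ^ e)⁻¹, Φ₁ t / t ^ N₀] R = 0) →
      (∃ R : MvPolynomial (Fin 2) ℚ, R ≠ 0 ∧ ∀ t : ℂ, 0 < ‖t‖ → ‖t‖ < r →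
        MvPolynomial.aeval ![Φ₁ t / t ^ N₀, Complex.exp (ℓ₀ t)] R = 0) →
      (∃ R : MvPolynomial (Fin 2) ℚ, R ≠ 0 ∧ ∀ t : ℂ, 0 < ‖t‖ → ‖t‖ < r →
        MvPolynomial.aeval ![Φ₁ t / t ^ N₀, Complex.exp (ℓ₁ t)] R = 0) →
      (∃ R : MvPolynomial (Fin 2) ℚ, R ≠ 0 ∧ ∀ t : ℂ, 0 < ‖t‖ → ‖t‖ < r →
        MvPolynomial.aeval ![Complex.exp (ℓ₀ t), Complex.exp (ℓ₁ t)] R = 0) →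
      (∀ n : ℕ, IsAlgebraic ℚ (iteratedDeriv n Φ₁ 0)) →
      IsAlgebraic ℚ (Complex.exp (ℓ₀ 0)) → IsAlgebraic ℚ (Complex.exp (ℓ₁ 0)) →
      (∀ n : ℕ, 0 < n → IsAlgebraic ℚ (iteratedDeriv n ℓ₀ 0)) →
      (∀ n : ℕ, 0 < n → IsAlgebraic ℚ (iteratedDeriv n ℓ₁ 0)) →
      AnalyticAt ℂ G 0 → (∀ t : ℂ, 0 < ‖t‖ → ‖t‖ < r → Φ₁ t / t ^ N₀ = β * (t ^ e)⁻¹ + G t) →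
      IsAlgebraic ℚ β →
      (¬ ∀ᶠ t in 𝓝 (0 : ℂ), ℓ₀ t = ℓ₀ 0 ∧ ℓ₁ t = ℓ₁ 0) →
      (∀ (e q : ℕ) (m₁ : ℤ) (β : ℂ) (Φ : ℂ → ℂ) (t c : ℕ → ℂ) (lam : ℂ),
        0 < e → 0 < q → β.im = 0 → IsAlgebraic ℚ β →
        AnalyticAt ℂ Φ 0 → Φ 0 = 0 → (¬ ∀ᶠ z in 𝓝 (0 : ℂ), Φ z = 0) →
        (∀ n : ℕ, IsAlgebraic ℚ (iteratedDeriv n Φ 0)) →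
        (∀ j : ℕ, j < e * ((minpoly ℚ β).natDegree - 1) → iteratedDeriv j Φ 0 = 0) →
        Tendsto t atTop (𝓝 0) → Tendsto c atTop (𝓝 lam) →
        (∀ᶠ n : ℕ in atTop, t n ≠ 0 ∧ ((t n) ^ e)⁻¹ = 2 * ↑π * I * (n : ℂ) + c n) →
        Set.Finite {n : ℕ | ∃ L : ℤ,
          β * ((q : ℂ) * (n : ℂ) + (m₁ : ℂ)) + (q : ℂ) * Φ (t n) / (2 * ↑π * I) = L}) →
      (IsAlgebraic ℚ β → (∀ n : ℕ, IsAlgebraic ℚ (iteratedDeriv n G 0)) →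
        (∀ r' : ℚ, (r' : ℂ) ≠ β) →
        (¬ ∀ᶠ t in 𝓝 (0 : ℂ), ℓ₀ t = ℓ₀ 0 ∧ ℓ₁ t = ℓ₁ 0) →
        ((∃ q : ℕ, 0 < q ∧ Complex.exp (ℓ₀ 0) ^ q = 1 ∧ Complex.exp (ℓ₁ 0) ^ q = 1) → G 0 ≠ 0) →
        Set.Finite {n : ℕ | LinearIndependent ℚ (x n) ∧ ∃ L : ℤ, A.eval (w n) + g (w n)⁻¹ = L}) →
      (∀ (q : ℕ) (m₀ m₁ : ℤ), IsAlgebraic ℚ β → (∀ n : ℕ, IsAlgebraic ℚ (iteratedDeriv n G 0)) →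
        (∀ r' : ℚ, (r' : ℂ) ≠ β) →
        β.im = 0 → 0 < q → (q : ℂ) * ℓ₀ 0 = 2 * ↑π * I * (m₀ : ℂ) →
        (q : ℂ) * ℓ₁ 0 = 2 * ↑π * I * (m₁ : ℂ) → G 0 = 0 →
        (¬ ∀ᶠ t in 𝓝 (0 : ℂ), ℓ₀ t = ℓ₀ 0 ∧ ℓ₁ t = ℓ₁ 0) →
        (∃ j : ℕ, j ≤ e ∧ j < e * ((minpoly ℚ β).natDegree - 1) ∧
          (∀ i : ℕ, i < j → iteratedDeriv i (fun t => β * (ℓ₀ t - ℓ₀ 0) - (ℓ₁ t - ℓ₁ 0) + G t) 0 = 0) ∧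
          iteratedDeriv j (fun t => β * (ℓ₀ t - ℓ₀ 0) - (ℓ₁ t - ℓ₁ 0) + G t) 0 ≠ 0) →
        Set.Finite {n : ℕ | LinearIndependent ℚ (x n) ∧ ∃ L : ℤ, A.eval (w n) + g (w n)⁻¹ = L}) →
      Set.Finite {n : ℕ | LinearIndependent ℚ (x n) ∧ ∃ L : ℤ, A.eval (w n) + g (w n)⁻¹ = L} := by
  intro e N₀ A g ℓu ℓv T ℓ₀ ℓ₁ Φ₁ G ρ r β w x' he hρ hr hg hg0 hu hv hT hT0 h₀ h₁ hΦ₁ htr hrat hreal hlink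
    hW' hR₁ hR₂ hR₃ hR₄ hR₅ hR₆ hΦ₁alg hα₀ hα₁ hℓ₀alg hℓ₁alg hG hjet hβalg hconst hDeep hA2 hA1
  have hw_pow : ∀ N : ℕ, (w N) ^ e = (N : ℂ) := fun N => rayAbscissa_pow he N
  have hw_inv_pow : ∀ N : ℕ, ((w N)⁻¹)⁻¹ ^ e = (N : ℂ) := fun N => by rw [inv_inv, hw_pow]
  have h2pi : (2 * (π : ℂ) * I) ≠ 0 := by simp [Real.pi_ne_zero, I_ne_zero]
  obtain ⟨R₃, hR₃0, hR₃'⟩ := hR₃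
  /- ray points tend to `0` inside the punctured disc; `T σ_N → 0`, `ℓu σ_N → ℓu 0` -/
  have hσmem : ∀ᶠ N : ℕ in atTop, 0 < ‖(w N)⁻¹‖ ∧ ‖(w N)⁻¹‖ < ρ :=
    eventually_rayPoint_mem_puncturedDisc he hρ
  have hσlim : Tendsto (fun N => (w N)⁻¹) atTop (𝓝 0) :=
    (tendsto_rayPoint_nhdsNE he).mono_right nhdsWithin_le_nhds
  have htlim : Tendsto (fun N => T (w N)⁻¹) atTop (𝓝 0) := by
    have h := (hT.continuousAt.tendsto).comp hσlim
    rwa [hT0] at h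
  have hculim : Tendsto (fun N => ℓu (w N)⁻¹) atTop (𝓝 (ℓu 0)) :=
    (hu.continuousAt.tendsto).comp hσlim
  have hfin_of_eventually : ∀ {P : ℕ → Prop}, (∀ᶠ N in atTop, P N) → Set.Finite {N | ¬ P N} := by
    intro P hP
    rwa [← Nat.cofinite_eq_atTop, Filter.eventually_cofinite] at hP
  /- (a) the σ-side jet is `A = β w^e + a₀` -/
  have hjetσ : ∀ σ : ℂ, 0 < ‖σ‖ → ‖σ‖ < ρ →
      2 * ↑π * I * (A.eval σ⁻¹ + g σ) + ℓv σ = β * (2 * ↑π * I * σ⁻¹ ^ e + ℓu σ) + G (T σ) := by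
    intro σ hσ1 hσ2
    obtain ⟨hT1, hT2, h3, h4, -, -⟩ := hlink σ hσ1 hσ2
    rw [← h4, ← h3]
    exact hjet _ hT1 hT2
  obtain ⟨a₀, hAeq⟩ := linearJet_normalForm hρ hg hu hv hT hT0 hG hlink hjet
  have hAeval : ∀ z : ℂ, A.eval z = β * z ^ e + a₀ := by
    intro z
    rw [hAeq, Polynomial.eval_add, Polynomial.eval_mul, Polynomial.eval_C, Polynomial.eval_pow,
      Polynomial.eval_X, Polynomial.eval_C]
  have hAcoeff : A.coeff e = β := (coeff_natDegree_of_eq_C_mul_X_pow_add_C he hAeq).1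
  have hAw : ∀ N : ℕ, A.eval (w N) = β * N + a₀ := fun N => by rw [hAeval, hw_pow]
  /- (b) `β` is real, irrational and algebraic -/
  have hβim : β.im = 0 := by rw [← hAcoeff]; exact hreal.1 e
  have hβirr : ∀ r' : ℚ, (r' : ℂ) ≠ β := by
    intro r' hr'
    apply hrat
    refine ⟨Polynomial.C r' * Polynomial.X, a₀, fun N => ?_⟩
    rw [hAw, Polynomial.map_mul, Polynomial.map_C, Polynomial.map_X, Polynomial.eval_mul,
      Polynomial.eval_C, Polynomial.eval_X, ← hr', eq_ratCast]
  /- (c) the Taylor coefficients of `G` are algebraic: `G` solves `R₃(t⁻ᵉ, β t⁻ᵉ + G t) = 0` -/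
  have hGalg : ∀ n : ℕ, IsAlgebraic ℚ (iteratedDeriv n G 0) :=
    isAlgebraic_iteratedDeriv_of_linearJet stub_taylorLogCoeffsAlgebraic.1 he hG hβalg hr hR₃0 hR₃' hjet
  /- (d) the defect germ `Φ` and the hit identity -/
  set Φ : ℂ → ℂ := fun t => β * (ℓ₀ t - ℓ₀ 0) - (ℓ₁ t - ℓ₁ 0) + G t with hΦdef
  have hΦan : AnalyticAt ℂ Φ 0 :=
    ((analyticAt_const.mul (h₀.sub analyticAt_const)).sub (h₁.sub analyticAt_const)).add hG
  have hgΦ : ∀ σ : ℂ, 0 < ‖σ‖ → ‖σ‖ < ρ →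
      2 * ↑π * I * g σ = Φ (T σ) + (β * ℓ₀ 0 - ℓ₁ 0 - 2 * ↑π * I * a₀) := by
    intro σ hσ1 hσ2
    obtain ⟨-, -, -, -, h5, h6⟩ := hlink σ hσ1 hσ2
    have hj := hjetσ σ hσ1 hσ2
    rw [hAeval] at hj
    simp only [hΦdef, h5, h6]
    linear_combination hj
  have hhit : ∀ᶠ N : ℕ in atTop, ∀ L : ℤ, A.eval (w N) + g (w N)⁻¹ = L →
      2 * ↑π * I * (L : ℂ) = 2 * ↑π * I * β * N + Φ (T (w N)⁻¹) + (β * ℓ₀ 0 - ℓ₁ 0) := by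
    filter_upwards [hσmem] with N hN L hL
    have hj := hgΦ _ hN.1 hN.2
    rw [hAw] at hL
    linear_combination (-(2 * ↑π * I)) * hL + hj
  -- `Φ` is not identically zero near `0`: otherwise `g ≡ 0`, contradicting transcendence
  have hΦne : ¬ ∀ᶠ z in 𝓝 (0 : ℂ), Φ z = 0 := by
    intro hΦz
    have h1 : ∀ᶠ σ in 𝓝 (0 : ℂ), Φ (T σ) = 0 := by
      have hTc : Tendsto T (𝓝 0) (𝓝 0) := by
        have h := hT.continuousAt.tendsto
        rwa [hT0] at h
      exact hTc.eventually hΦz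
    set κ : ℂ := (β * ℓ₀ 0 - ℓ₁ 0 - 2 * ↑π * I * a₀) / (2 * ↑π * I) with hκ
    have h2 : ∀ᶠ σ in 𝓝[≠] (0 : ℂ), g σ = κ := by
      filter_upwards [mem_nhdsWithin_of_mem_nhds h1, puncturedDisc_mem_nhdsNE hρ] with σ hσ1 hσ2
      have hj := hgΦ σ hσ2.1 hσ2.2
      rw [hσ1, zero_add] at hj
      rw [hκ]
      field_simp
      linear_combination hj
    have h3 : κ = 0 := by
      have hgt : Tendsto g (𝓝[≠] (0 : ℂ)) (𝓝 (g 0)) :=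
        hg.continuousAt.tendsto.mono_left nhdsWithin_le_nhds
      have hct : Tendsto (fun _ : ℂ => κ) (𝓝[≠] (0 : ℂ)) (𝓝 (g 0)) := hgt.congr' h2
      rw [hg0] at hct
      exact tendsto_nhds_unique tendsto_const_nhds hct
    have h4 : ∀ᶠ σ in 𝓝 (0 : ℂ), g σ = 0 := by
      have h2' : ∀ᶠ σ in 𝓝[≠] (0 : ℂ), g σ = 0 := by simpa only [h3] using h2
      rw [eventually_nhdsWithin_iff] at h2'
      filter_upwards [h2'] with σ hσ
      by_cases hs : σ = 0
      · rw [hs, hg0]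
      · exact hσ hs
    exact htr ⟨MvPolynomial.X 1, MvPolynomial.X_ne_zero _, by
      filter_upwards [h4] with z hz
      simp [hz]⟩
  -- Taylor coefficients of `Φ` are algebraic
  have hΦalg : ∀ n : ℕ, IsAlgebraic ℚ (iteratedDeriv n Φ 0) :=
    isAlgebraic_iteratedDeriv_defectGerm h₀ h₁ hG hβalg hℓ₀alg hℓ₁alg hGalg
  /- (e) torsion split -/
  by_cases htorG : (∃ q : ℕ, 0 < q ∧ Complex.exp (ℓ₀ 0) ^ q = 1 ∧ Complex.exp (ℓ₁ 0) ^ q = 1) ∧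
      G 0 = 0
  swap
  · -- inhomogeneous cusp: atom A2
    exact hA2 hβalg hGalg hβirr hconst (fun ht hG0 => htorG ⟨ht, hG0⟩)
  obtain ⟨⟨q, hq, hq0, hq1⟩, hG0⟩ := htorG
  obtain ⟨m₀, hm₀⟩ : ∃ m₀ : ℤ, (q : ℂ) * ℓ₀ 0 = m₀ * (2 * ↑π * I) :=
    Complex.exp_eq_one_iff.mp (by rw [Complex.exp_nat_mul]; exact hq0)
  obtain ⟨m₁, hm₁⟩ : ∃ m₁ : ℤ, (q : ℂ) * ℓ₁ 0 = m₁ * (2 * ↑π * I) :=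
    Complex.exp_eq_one_iff.mp (by rw [Complex.exp_nat_mul]; exact hq1)
  have hm₀' : (q : ℂ) * ℓ₀ 0 = 2 * ↑π * I * (m₀ : ℂ) := by rw [hm₀]; ring
  have hm₁' : (q : ℂ) * ℓ₁ 0 = 2 * ↑π * I * (m₁ : ℂ) := by rw [hm₁]; ring
  have hΦ0 : Φ 0 = 0 := by simp [hΦdef, hG0]
  -- the order `k` of `Φ` at `0`
  obtain ⟨k, hlt, hk⟩ := exists_order_of_not_eventually_zero hΦan hΦne
  -- data for the pockets along the ray: `t n = T σ_n`, `c n = ℓu σ_n`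
  have hrelt : ∀ᶠ n : ℕ in atTop, T (w n)⁻¹ ≠ 0 ∧
      ((T (w n)⁻¹) ^ e)⁻¹ = 2 * ↑π * I * (n : ℂ) + ℓu (w n)⁻¹ := by
    filter_upwards [hσmem] with n hn
    obtain ⟨hT1, -, h3, -, -, -⟩ := hlink _ hn.1 hn.2
    exact ⟨norm_pos_iff.mp hT1, by rw [h3, hw_inv_pow]⟩
  -- transport: a late hit `L` is a pocket hit with `L' = q L + m₁`
  have htransport : Set.Finite {n : ℕ | ∃ L : ℤ,
      β * ((q : ℂ) * (n : ℂ) + (m₀ : ℂ)) + (q : ℂ) * Φ (T (w n)⁻¹) / (2 * ↑π * I) = L} →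
      Set.Finite {N : ℕ | LinearIndependent ℚ (x' N) ∧ ∃ L : ℤ, A.eval (w N) + g (w N)⁻¹ = L} := by
    intro hfin
    refine ((hfin_of_eventually hhit).union hfin).subset ?_
    rintro N ⟨-, L, hL⟩
    by_cases hP : ∀ L : ℤ, A.eval (w N) + g (w N)⁻¹ = L →
        2 * ↑π * I * (L : ℂ) = 2 * ↑π * I * β * N + Φ (T (w N)⁻¹) + (β * ℓ₀ 0 - ℓ₁ 0)
    · right
      refine ⟨q * L + m₁, ?_⟩
      have h1 := hP L hL
      push_cast
      rw [← mul_right_inj' h2pi, mul_add, mul_div_cancel₀ _ h2pi]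
      linear_combination (-(q : ℂ)) * h1 - β * hm₀' + hm₁'
    · exact Or.inl hP
  by_cases hkd : e * ((minpoly ℚ β).natDegree - 1) ≤ k
  · exact htransport (hDeep e q m₀ β Φ (fun n => T (w n)⁻¹) (fun n => ℓu (w n)⁻¹) (ℓu 0) he hq
      hβim hβalg hΦan hΦ0 hΦne hΦalg (fun j hj => hlt j (lt_of_lt_of_le hj hkd)) htlim hculim hrelt)
  by_cases hke : e < k
  · exact htransport (stub_rothCuspFinite e q m₀ β Φ (fun n => T (w n)⁻¹) (fun n => ℓu (w n)⁻¹) (ℓu 0) he hq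
      hβim hβalg hΦan hΦ0 hΦne (fun j hj => hlt j (lt_of_le_of_lt hj hke)) htlim hculim hrelt)
  -- depth `≤ 1`: atom A1
  push Not at hkd hke
  exact hA1 q m₀ m₁ hβalg hGalg hβirr hβim hq hm₀' hm₁' hG0 hconst ⟨k, hke, hkd, hlt, hk⟩

end Summit.Schanuel.Schanuel.Cruxes.SparsityTwo.CuspGermSchneiderSparsity
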